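import Summits.QuantumAdvantage.QuantumAdvantage.Theorems.FactoringAssumption
import Literature.NumberTheory.Sieve.ChenTwinSieveLower

/-!
# Route `WhiteBoxWalk`, crux `WbwThesis` (stmt-QuantumAdvantage-2238), line `Sketch`: density of `m`-bit primes

Part (A) of stub `stub_weakOW` (weak one-wayness of the prime-pair product `fPQ` from the factoring
assumption): the number `π_m = #mbitPrimes m` of `m`-bit primes (`2^{m-1} ≤ p < 2^m`) satisfies
`2^m ≤ 4 m · π_m` for all large `m`, i.e. a uniformly random `m`-bit string is an `m`-bit prime with
probability `≥ 1/(4m)`.  This is the prime number theorem on the dyadic window: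
`π_m = π(2^m) - π(2^{m-1})` for `m ≥ 2` and, with `η = 1/10` in the tree's two-sided PNT bounds
`(1-η) x/log x ≤ π(x) ≤ (1+η) x/log x` (`Literature.NumberTheory.Sieve.Chen.eventually_primeCounting_bounds`),
`π(2^{k+1}) - π(2^k) ≥ (9/10)·2^{k+1}/((k+1) log 2) - (11/10)·2^k/(k log 2) ≥ 2^{k+1}/(4(k+1))`
for `k ≥ 4` (`log 2 < 0.6932`).

Sub-namespace `Density`; no definitions.

References: H. L. Montgomery, R. C. Vaughan, *Multiplicative Number Theory I* (2007), §8.1 (8.1);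
O. Goldreich, *Foundations of Cryptography I* (2001), §2.2.4.1 (density of primes, the factoring
candidate).
-/

set_option linter.dupNamespace false -- D-0017: single-problem summit ⇒ `QuantumAdvantage.QuantumAdvantage` by design

namespace Summit.QuantumAdvantage.QuantumAdvantage.Theorems.WhiteBoxWalk

open Summit.QuantumAdvantage.QuantumAdvantage.Theorems (mbitPrimes mem_mbitPrimes)
open Filter Finset

namespace Density

/-- The window count: `#mbitPrimes (k+1) + π'(2^k) = π'(2^{k+1})` (`π' n` = number of primes `< n`).
[folklore] -/
theorem card_mbitPrimes_add (k : ℕ) :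
    (mbitPrimes (k + 1)).card + Nat.primeCounting' (2 ^ k) = Nat.primeCounting' (2 ^ (k + 1)) := by
  have hd : Disjoint ((Ico (2 ^ k) (2 ^ (k + 1))).filter Nat.Prime) ((Ico 0 (2 ^ k)).filter Nat.Prime) :=
    disjoint_filter_filter (Ico_disjoint_Ico_consecutive 0 (2 ^ k) (2 ^ (k + 1))).symm
  rw [← Nat.primesBelow_card_eq_primeCounting', ← Nat.primesBelow_card_eq_primeCounting',
    Nat.primesBelow_eq_filter_Ico_zero, Nat.primesBelow_eq_filter_Ico_zero, mbitPrimes,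
    Nat.add_sub_cancel, ← card_union_of_disjoint hd, ← filter_union, union_comm,
    Ico_union_Ico_eq_Ico (Nat.zero_le _) (Nat.pow_le_pow_right two_pos k.le_succ)]

/-- `2^{k+1}` is not prime. [folklore] -/
theorem not_prime_two_pow_succ (k : ℕ) (hk : 1 ≤ k) : ¬ (2 ^ (k + 1)).Prime := by
  intro hp
  have h2 : (2 : ℕ) ∣ 2 ^ (k + 1) := dvd_pow_self 2 (Nat.succ_ne_zero k)
  have h := (Nat.prime_dvd_prime_iff_eq Nat.prime_two hp).1 h2
  have : 2 ^ 2 ≤ 2 ^ (k + 1) := Nat.pow_le_pow_right two_pos (by omega)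
  omega

/-- The window count dominates `π(2^{k+1}) - π(2^k)` (for `k ≥ 1`; in `ℝ`). [folklore] -/
theorem sub_le_card_mbitPrimes (k : ℕ) (hk : 1 ≤ k) :
    (Nat.primeCounting (2 ^ (k + 1)) : ℝ) - Nat.primeCounting (2 ^ k) ≤ (mbitPrimes (k + 1)).card := by
  have h1 : Nat.primeCounting (2 ^ (k + 1)) = Nat.primeCounting' (2 ^ (k + 1)) := by
    rw [Nat.primeCounting_eq_primeCounting'_succ, Nat.primeCounting', Nat.count_succ,
      if_neg (not_prime_two_pow_succ k hk), Nat.add_zero]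
  have h2 : Nat.primeCounting' (2 ^ k) ≤ Nat.primeCounting (2 ^ k) :=
    Nat.monotone_primeCounting' (Nat.le_succ _)
  have h3 := card_mbitPrimes_add k
  have h4 : (Nat.primeCounting (2 ^ (k + 1)) : ℝ) = (mbitPrimes (k + 1)).card + Nat.primeCounting' (2 ^ k) := by
    rw [h1]; exact_mod_cast h3.symm
  rw [h4]
  have h5 : (Nat.primeCounting' (2 ^ k) : ℝ) ≤ Nat.primeCounting (2 ^ k) := by exact_mod_cast h2
  linarith

end Density

/-- **Density of `m`-bit primes** (part (A) of stub `stub_weakOW`; PNT on a dyadic window): eventually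
`2^m ≤ 4 m · #mbitPrimes m` — with `η = 1/10` in the two-sided PNT bounds at `2^k` and `2^{k+1}`,
`π(2^{k+1}) - π(2^k) ≥ 2^{k+1}/(4(k+1))` for `k ≥ 4`, and the window count dominates the difference
(`Density.sub_le_card_mbitPrimes`). [Montgomery–Vaughan 2007, §8.1 (8.1); Goldreich 2001, §2.2.4.1] -/
theorem stub_weakOW_density :
    ∀ᶠ m : ℕ in atTop, (2 : ℝ) ^ m ≤ 4 * m * ((mbitPrimes m).card : ℝ) := by
  have hPNT := Literature.NumberTheory.Sieve.Chen.eventually_primeCounting_bounds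
    (η := 1 / 10) (by norm_num)
  obtain ⟨N, hN⟩ := eventually_atTop.1 hPNT
  refine eventually_atTop.2 ⟨N + 5, fun m hm => ?_⟩
  obtain ⟨k, rfl⟩ : ∃ k, m = k + 1 := ⟨m - 1, by omega⟩
  have hk4 : 4 ≤ k := by omega
  have hkN : N ≤ 2 ^ k := by
    have := Nat.lt_two_pow_self (n := k)
    omega
  have hkN' : N ≤ 2 ^ (k + 1) := hkN.trans (Nat.pow_le_pow_right two_pos k.le_succ)
  obtain ⟨hlo, -⟩ := hN _ hkN'
  obtain ⟨-, hhi⟩ := hN _ hkN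
  have hL0 : 0 < Real.log 2 := Real.log_pos one_lt_two
  have hL1 : Real.log 2 < 0.6932 := Real.log_two_lt_d9.trans (by norm_num)
  set L := Real.log 2 with hL
  set t : ℝ := (2 : ℝ) ^ k with ht
  have ht0 : 0 < t := by positivity
  have hkr : (4 : ℝ) ≤ k := by exact_mod_cast hk4
  -- the PNT bounds at `2^{k+1}` and `2^k`, in closed form
  have e1 : ((2 ^ (k + 1) : ℕ) : ℝ) = 2 * t := by push_cast; ring
  have e2 : ((2 ^ k : ℕ) : ℝ) = t := by push_cast; rfl
  have l1 : Real.log (2 * t) = (k + 1) * L := by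
    rw [ht, ← pow_succ', Real.log_pow]; push_cast; ring
  have l2 : Real.log t = k * L := by rw [ht, Real.log_pow]
  rw [e1, l1] at hlo
  rw [e2, l2] at hhi
  have hcard := Density.sub_le_card_mbitPrimes k (by omega)
  -- the arithmetic: `2t ≤ 4(k+1)·((9/10)·2t/((k+1)L) - (11/10)·t/(kL))`
  have hk0 : (0 : ℝ) < k := by linarith
  have hk1 : (0 : ℝ) < k + 1 := by linarith
  have key : (2 : ℝ) ^ (k + 1) ≤ 4 * ((k + 1 : ℕ) : ℝ) *
      ((1 - 1 / 10) * (2 * t / ((k + 1) * L)) - (1 + 1 / 10) * (t / (k * L))) := by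
    have hid : 4 * ((k : ℝ) + 1) * ((1 - 1 / 10) * (2 * t / ((k + 1) * L)) - (1 + 1 / 10) * (t / (k * L)))
        - 2 * t = t / (L * k) * ((14 / 5 - 2 * L) * k - 22 / 5) := by
      field_simp
      ring
    have hpos : 0 ≤ t / (L * k) * ((14 / 5 - 2 * L) * k - 22 / 5) := by
      refine mul_nonneg (by positivity) ?_
      nlinarith
    rw [pow_succ, Nat.cast_add, Nat.cast_one]
    linarith
  refine key.trans (mul_le_mul_of_nonneg_left (by linarith) (by positivity))

end Summit.QuantumAdvantage.QuantumAdvantage.Theorems.WhiteBoxWalk
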